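/-
Copyright (c) 2026 the pub-hodgecm-mathlib formalisation cell (harness21).  Prover seat hodgecm-mathlib-A-p16 (g29), architect of road «S3-tree»
(ruling A-57 (a) S-a), 2026-09-01.
-/
import Mathlib.LinearAlgebra.FreeModule.PID
import Mathlib.LinearAlgebra.Matrix.NonsingularInverse
import Literature.NumberTheory.Automorphic.UnitaryLatticeTreeDefs   -- ★ T1a (B-p14 (g35)): `latt`, `stdLattice`, `mapGL`
import HarnessLib

/-!
# Every `𝒪`-lattice squeezed between two framed lattices is framed: `latt a ≤ M ≤ latt b ⟹ M = latt g` (elementary divisors over the valuation ring)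

Topic `NumberTheory/Automorphic`; namespace `Literature.NumberTheory.Automorphic.UnitaryLatticeTree`.  THEOREMS ONLY (no definition, no instance, no notation, no
named fact, no `sorry`); kernel lane.  Cell `pub/hodgecm-mathlib` (D-0151), crux H413 = `stmt-HodgeConjecture-24833`, road «S3-tree» (LEAD F0P3a-plan (g11) WORD T10-2),
END CONTRACT stub «SPAN», architect ruling A-57 (a) brick **S-a «VERTEX-FIXING»**, FILE 0: the bridge from INTRINSIC `𝒪`-submodules of `K^N` to the FRAMED lattices
`latt g = g·𝒪^N` of ★ T1a `UnitaryLatticeTreeDefs` (whose vertex predicate `IsVertexLattice` quantifies over frames `g ∈ GL_N(K)`).  The vertex-fixing iteration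
(FILE 1) produces `δ`-stable lattices by Cayley–Hamilton sums `Σ 𝒪·δ^i L₀` and integral hulls `N + ϖ^{e−1}N^♯`; this file frames them.
HONEST LABEL: HC_CM is proved only modulo the printed citations until rung 0 closes; this file is linear algebra over a principal valuation ring and pays no letter.

THE MATHEMATICS.  `K` a field with `Valued K ℤᵐ⁰` whose valuation ring `𝒪 = 𝒪[K]` is a principal ideal ring (a DVR: e.g. `K = L_w`).  (§1) `𝒪^N = span_𝒪(e_i)` and
`latt g = span_𝒪(columns of g)`.  (§2) For a family of vectors in a `K`-space, `𝒪`-linear independence = `K`-linear independence (clear the coefficient of LARGEST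
valuation).  (§3) If `latt a ≤ M ≤ latt b` with `a, b ∈ GL_N(K)`, then `M ≤ span_𝒪(cols b)` is free over the PID `𝒪` (Mathlib `Submodule.basisOfPidOfLESpan`) of some
rank `n ≤ N` (its basis is `K`-free in `K^N`), and `n ≥ N` (the columns of `a` are `N` independent vectors of `M`); the basis vectors are the columns of some `g ∈ GL_N(K)`
with `latt g = M`.  [Serre, *Local Fields*, Ch. II §2 (lattices over a DVR are free); O'Meara §81:11.]

* §1 `stdLattice_eq_span_basisFun`, `latt_eq_span_col`.
* §2 `linearIndependent_integer_iff` (`𝒪`-independent ↔ `K`-independent).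
* §3 **`exists_eq_latt_of_latt_le_of_le_latt`** (`∃ g : GL (Fin N) K, M = latt g`), `exists_eq_latt_of_stdLattice_le_of_le` (the case `a = 1`, `b = ϖ^{-k}·1` spelled with
  `scaleLattice`-free bounds `𝒪^N ≤ M ≤ latt b`).

## References
* [Serre1979] J.-P. Serre, *Local Fields*, GTM 67 (1979): Ch. II §2 (lattices over a discrete valuation ring).
* [Omeara1963] O. T. O'Meara, *Introduction to Quadratic Forms* (1963): §81:11 (lattices over principal ideal domains are free).
-/

set_option autoImplicit false

noncomputable section

open scoped Valued WithZero Matrix MatrixGroups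

namespace Literature.NumberTheory.Automorphic.UnitaryLatticeTree

open Literature.NumberTheory.Automorphic Literature.NumberTheory.Automorphic.HermitianLattice

variable {K : Type*} [Field K] [Valued K ℤᵐ⁰] {N : ℕ}

/-! ## §1 The standard lattice and the framed lattices as spans -/

/-- `𝒪^N = span_𝒪 {e_i}`. [cite: Omeara1963, §81A] -/
theorem stdLattice_eq_span_basisFun : stdLattice K N = Submodule.span 𝒪[K] (Set.range (Pi.basisFun K (Fin N))) := by
  classical
  refine le_antisymm ?_ (Submodule.span_le.2 ?_)
  · intro v hv
    rw [mem_stdLattice] at hv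
    have : v = ∑ i, (⟨v i, (mem_integer_iff' _).2 (hv i)⟩ : 𝒪[K]) • (Pi.basisFun K (Fin N) i) := by
      ext j
      simp only [Finset.sum_apply, Pi.smul_apply, Pi.basisFun_apply]
      rw [Finset.sum_eq_single j]
      · change v j = v j * (Pi.single j (1 : K) : Fin N → K) j
        rw [Pi.single_eq_same, mul_one]
      · intro i _ hij
        change v i * (Pi.single i (1 : K) : Fin N → K) j = 0
        rw [Pi.single_eq_of_ne (Ne.symm hij), mul_zero]
      · intro h; exact absurd (Finset.mem_univ j) h
    rw [this]
    exact Submodule.sum_mem _ fun i _ => Submodule.smul_mem _ _ (Submodule.subset_span ⟨i, rfl⟩)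
  · rintro _ ⟨i, rfl⟩
    rw [Pi.basisFun_apply]
    exact single_mem_stdLattice i

/-- `latt g = span_𝒪 {columns of g}`. [cite: Omeara1963, §81A] -/
theorem latt_eq_span_col (g : Matrix (Fin N) (Fin N) K) : latt g = Submodule.span 𝒪[K] (Set.range fun j => g.col j) := by
  classical
  rw [latt, stdLattice_eq_span_basisFun, Submodule.map_span]
  congr 1
  ext v
  simp only [Set.mem_image, Set.mem_range, exists_exists_eq_and]
  constructor
  · rintro ⟨i, rfl⟩
    refine ⟨i, ?_⟩
    change g.col i = Matrix.toLin' g (Pi.basisFun K (Fin N) i)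
    rw [Pi.basisFun_apply, Matrix.toLin'_apply, Matrix.mulVec_single_one]
  · rintro ⟨i, rfl⟩
    refine ⟨i, ?_⟩
    change Matrix.toLin' g (Pi.basisFun K (Fin N) i) = g.col i
    rw [Pi.basisFun_apply, Matrix.toLin'_apply, Matrix.mulVec_single_one]

/-! ## §2 `𝒪`-linear independence is `K`-linear independence -/

/-- **In a `K`-vector space, a family is `𝒪`-linearly independent iff it is `K`-linearly independent**: a `K`-relation, divided by its coefficient of largest valuation,
is an `𝒪`-relation with a coefficient `1`. [cite: Omeara1963, §81:11] [cite: Serre1979, Ch. II §2] -/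
theorem linearIndependent_integer_iff {ι : Type*} {V : Type*} [AddCommGroup V] [Module K V] (b : ι → V) :
    LinearIndependent 𝒪[K] b ↔ LinearIndependent K b := by
  classical
  constructor
  · intro h
    rw [linearIndependent_iff'] at h ⊢
    intro s c hc i hi
    by_contra hci
    -- the coefficient of largest valuation
    obtain ⟨j, hjs, hj⟩ := Finset.exists_max_image s (fun k => Valued.v (c k)) ⟨i, hi⟩
    have hcj : c j ≠ 0 := by
      intro h0
      have := hj i hi
      rw [h0, map_zero] at this
      exact hci ((Valued.v.zero_iff).1 (le_antisymm this zero_le))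
    -- the normalised relation has integral coefficients and coefficient `1` at `j`
    let c' : ι → 𝒪[K] := fun k => if hk : k ∈ s then ⟨c k / c j, (mem_integer_iff' _).2 (by
        rw [map_div₀]
        exact div_le_one_of_le₀ (hj k hk) zero_le)⟩ else 0
    have hrel : ∑ k ∈ s, c' k • b k = 0 := by
      have : ∑ k ∈ s, c' k • b k = (c j)⁻¹ • ∑ k ∈ s, c k • b k := by
        rw [Finset.smul_sum]
        refine Finset.sum_congr rfl fun k hk => ?_
        simp only [c', dif_pos hk]
        change ((c k / c j : K)) • b k = (c j)⁻¹ • c k • b k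
        rw [smul_smul, div_eq_inv_mul]
      rw [this, hc, smul_zero]
    have := h s c' hrel j hjs
    simp only [c', dif_pos hjs] at this
    have h1 : (c j / c j : K) = 0 := congrArg Subtype.val this
    rw [div_self hcj] at h1
    exact one_ne_zero h1
  · intro h
    exact h.restrict_scalars (by
      intro x y hxy
      apply Subtype.ext
      simpa using hxy)

/-! ## §3 Squeezed lattices are framed -/

/-- The columns of an invertible matrix are `𝒪`-linearly independent. [cite: Omeara1963, §81:11] -/
theorem linearIndependent_integer_col (b : GL (Fin N) K) : LinearIndependent 𝒪[K] fun j => (b : Matrix (Fin N) (Fin N) K).col j :=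
  (linearIndependent_integer_iff _).2 (Matrix.linearIndependent_cols_iff_isUnit.2 (Units.isUnit b))

/-- **SQUEEZED LATTICES ARE FRAMED.**  Over a principal valuation ring `𝒪 = 𝒪[K]` (a DVR), an `𝒪`-submodule `M ≤ K^N` with `latt a ≤ M ≤ latt b` for some
`a, b ∈ GL_N(K)` is `latt g` for some `g ∈ GL_N(K)`: `M` is free of rank `N` (a submodule of the free module `latt b` over a PID, containing the `N` independent columns
of `a`), and a basis assembled as the columns of `g` is a `K`-basis of `K^N`. [cite: Serre1979, Ch. II §2] [cite: Omeara1963, §81:11] -/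
theorem exists_eq_latt_of_latt_le_of_le_latt [IsPrincipalIdealRing 𝒪[K]] (a b : GL (Fin N) K) (M : Submodule 𝒪[K] (Fin N → K))
    (haM : latt (a : Matrix (Fin N) (Fin N) K) ≤ M) (hMb : M ≤ latt (b : Matrix (Fin N) (Fin N) K)) :
    ∃ g : GL (Fin N) K, M = latt (g : Matrix (Fin N) (Fin N) K) := by
  classical
  -- `M` sits inside the span of the (independent) columns of `b`: it is free of some finite rank `n`
  have hMb' : M ≤ Submodule.span 𝒪[K] (Set.range fun j => (b : Matrix (Fin N) (Fin N) K).col j) := by rwa [← latt_eq_span_col]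
  obtain ⟨n, bM⟩ := Submodule.basisOfPidOfLESpan (linearIndependent_integer_col b) hMb'
  haveI : Module.Finite 𝒪[K] M := Module.Finite.of_basis bM
  -- the basis vectors, seen in `K^N`, are `K`-linearly independent: `n ≤ N`
  have hnN : n ≤ N := by
    have hw𝒪 : LinearIndependent 𝒪[K] (fun i => (bM i : Fin N → K)) := bM.linearIndependent.map' M.subtype (Submodule.ker_subtype M)
    have hwK : LinearIndependent K (fun i => (bM i : Fin N → K)) := (linearIndependent_integer_iff _).1 hw𝒪
    have := hwK.fintype_card_le_finrank
    simpa using this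
  -- the columns of `a` are `N` independent vectors of `M`: `N ≤ n`
  have hNn : N ≤ n := by
    let u : Fin N → M := fun j => ⟨(a : Matrix (Fin N) (Fin N) K).col j, haM (by
      rw [latt_eq_span_col]; exact Submodule.subset_span ⟨j, rfl⟩)⟩
    have hu : LinearIndependent 𝒪[K] u := by
      refine LinearIndependent.of_comp M.subtype ?_
      exact linearIndependent_integer_col a
    have := hu.fintype_card_le_finrank
    rw [Fintype.card_fin, Module.finrank_eq_card_basis bM, Fintype.card_fin] at this
    exact this
  have hn : n = N := le_antisymm hnN hNn
  -- reindex by `Fin N` and assemble the frame from the basis vectors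
  let bN : Module.Basis (Fin N) 𝒪[K] M := bM.reindex (finCongr hn)
  let w : Fin N → (Fin N → K) := fun i => (bN i : Fin N → K)
  have hw𝒪 : LinearIndependent 𝒪[K] w := bN.linearIndependent.map' M.subtype (Submodule.ker_subtype M)
  have hwK : LinearIndependent K w := (linearIndependent_integer_iff w).1 hw𝒪
  let g : Matrix (Fin N) (Fin N) K := Matrix.of fun i j => w j i
  have hgcol : ∀ j, g.col j = w j := fun j => by ext i; rfl
  have hgK : LinearIndependent K g.col := by
    have : g.col = w := funext hgcol
    rw [this]; exact hwK
  have hgU : IsUnit g := Matrix.linearIndependent_cols_iff_isUnit.1 hgK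
  obtain ⟨gU, hgU'⟩ := hgU
  refine ⟨gU, ?_⟩
  rw [hgU', latt_eq_span_col]
  simp_rw [hgcol]
  -- `span (range w) = M`
  have hspan : Submodule.span 𝒪[K] (Set.range w) = M := by
    have h1 : Set.range w = M.subtype '' Set.range bN := by
      ext x
      simp only [Set.mem_range, Set.mem_image, exists_exists_eq_and, Submodule.coe_subtype, w]
    rw [h1, ← Submodule.map_span, bN.span_eq, Submodule.map_top, Submodule.range_subtype]
  exact hspan.symm

/-- **The case `𝒪^N ≤ M ≤ latt b`** (e.g. `M = Σ_{i<N} 𝒪·δ^i 𝒪^N ≤ ϖ^{-k}𝒪^N`): `M = latt g`. [cite: Serre1979, Ch. II §2] -/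
theorem exists_eq_latt_of_stdLattice_le_of_le_latt [IsPrincipalIdealRing 𝒪[K]] (b : GL (Fin N) K) (M : Submodule 𝒪[K] (Fin N → K))
    (hM : stdLattice K N ≤ M) (hMb : M ≤ latt (b : Matrix (Fin N) (Fin N) K)) :
    ∃ g : GL (Fin N) K, M = latt (g : Matrix (Fin N) (Fin N) K) :=
  exists_eq_latt_of_latt_le_of_le_latt 1 b M (by rw [Units.val_one, latt_one]; exact hM) hMb

end Literature.NumberTheory.Automorphic.UnitaryLatticeTree

end
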